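import Summits.AtomisticToContinuum.Crystallization.Theorems.PricedLinkCensusTruncatedCensusGapFarLocality
import Summits.AtomisticToContinuum.Crystallization.Theorems.TruncatedCensusGap.Negative.KappaZeroHalf
import Summits.AtomisticToContinuum.Crystallization.Theorems.PricedLinkCensusTruncatedCensusGapPeriodicStability
import Summits.AtomisticToContinuum.Crystallization.Theorems.PricedLinkCensusTruncatedCensusGapSuperstableRedistribution
import Literature.MathematicalPhysics.StatisticalMechanics.LennardJonesClusters

/-!
# Compact-strata reduction of the Barlow far-site gap (FAR)

Helper (FAR-SEPARATED REDUCTION) for the stub `stub_barlowFarSiteGap` (FAR, the open core) of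
the line `near-far-split` (`Cruxes/TruncatedCensusGap/Lines/near_far_split.lean`) of the crux
`PricedLinkCensus.TruncatedCensusGap` (item stmt-AtomisticToContinuum-14230); the FAR-twin of
c3's `truncatedCensusGap_of_separatedDense_of_locality` (`…SeparatedDenseReduction.lean`), with
CHARGE LOCALITY replaced by the landed FAR-LOCALITY `nearBarlow_sub_iff` (`…FarLocality.lean`,
constant radius `357/100`).

With `V = V_χ = min 1 (max 0 (4 - 2r)) · V_LJ` (range `2`), `e* = ⨅_Q e_V(Q)` and `Far(y)` the
sites of `y` that are not near-Barlow (the predicate `∃ a c s g, …` of the stub, spelled out):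
the far-site gap `N e* + κ #Far(y) ≤ E_V(y)` for UNIFORMLY `1/4`-SEPARATED, `2`-DENSE injective
configurations implies the far-site gap for ALL finite injective configurations (i.e. (FAR)),
with `κ' = min κ (1 / (24 (K + 1)))`, `K = (2 · (357/100) / (1/4) + 1)³` a packing constant.

Proof (verbatim the c3 scheme).  (a) The `1/4`-crowd-free sites are the range of an embedding
`f`; (b) by the landed Ruelle superstability in transfer form (`stub_superstableRedistribution`,
p124427) `E(y) ≥ E(y ∘ f)`; (c) dropping the sites of `y ∘ f` farther than `2` from every other
site (range of `g`) does not change the energy and leaves a `1/4`-separated `2`-dense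
configuration `z`; (d) the hypothesis prices `z`; (e) `e* ≤ -1/24` (pair cluster,
`iInf_energyPerParticle_le_div` and the landed periodic stability p84999), so the `N - L` dropped
sites contribute `≤ -(N - L)/24` to `N e*`; (f) a site of `z` far in `y` but near-Barlow in `z`
has, by FAR-LOCALITY, a dropped site within `357/100`, and by packing at most `K` crowd-free
sites lie within `357/100` of any site, so `#Far(y) ≤ (K + 1)(N - L) + #Far(z)`; (g) assemble.
So (FAR), like the crux, LIVES on the compact strata (rooted patches of bounded local
complexity); the separated periodic form is `…FarSeparatedPeriodicForm.lean`.

All `[folklore]` bookkeeping; the content of (FAR) is untouched.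
-/

namespace Summit.AtomisticToContinuum.Crystallization.Theorems.PricedLinkCensusTruncatedCensusGap

open scoped BigOperators Classical
open Literature.MathematicalPhysics.StatisticalMechanics Literature.Geometry.DiscreteGeometry

/-! ## Enumerations, packing, double counting (copies of c3's private lemmas) -/

/-- The sites satisfying a predicate are the range of an embedding `Fin M ↪ Fin N`. [folklore] -/
private theorem exists_enum' {N : ℕ} (p : Fin N → Prop) :
    ∃ (M : ℕ) (f : Fin M ↪ Fin N), ∀ k : Fin N, k ∈ Set.range f ↔ p k := by
  -- adapted from `exists_enum` (…SeparatedDenseReduction.lean)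
  set s := Finset.univ.filter fun k : Fin N => p k with hs
  refine ⟨s.card, (s.orderEmbOfFin rfl).toEmbedding, fun k => ?_⟩
  rw [show Set.range ⇑(s.orderEmbOfFin rfl).toEmbedding = Set.range (s.orderEmbOfFin rfl)
      from rfl, Finset.range_orderEmbOfFin, Finset.mem_coe, hs, Finset.mem_filter]
  simp

/-- Membership in `univ.map f` is membership in the range of `f`. [folklore] -/
private theorem mem_map_univ_iff' {M N : ℕ} (f : Fin M ↪ Fin N) (k : Fin N) :
    k ∈ Finset.univ.map f ↔ k ∈ Set.range f := by
  simp

/-- PACKING: at most `(2R/r₀ + 1)³` sites that are `r₀`-separated from every other site lie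
within `R` of any site (`card_le_of_separated_of_dist_le`). [folklore] -/
private theorem card_near_le' {N : ℕ} {y : Fin N → EuclideanSpace ℝ (Fin 3)}
    (hy : Function.Injective y) {r₀ R : ℝ} (hr₀ : 0 < r₀) (hR : 0 ≤ R) (j : Fin N) :
    ((Finset.univ.filter fun i : Fin N =>
        (∀ k : Fin N, k ≠ i → r₀ ≤ dist (y k) (y i)) ∧ dist (y i) (y j) ≤ R).card : ℝ) ≤
      (2 * R / r₀ + 1) ^ Module.finrank ℝ (EuclideanSpace ℝ (Fin 3)) := by
  -- adapted from `card_near_le` (…SeparatedDenseReduction.lean)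
  set S := Finset.univ.filter fun i : Fin N =>
    (∀ k : Fin N, k ≠ i → r₀ ≤ dist (y k) (y i)) ∧ dist (y i) (y j) ≤ R
  have hcard : (S.image y).card = S.card := Finset.card_image_of_injective _ hy
  have h := card_le_of_separated_of_dist_le (S.image y) (y j) hr₀ hR ?_ ?_
  · rwa [hcard] at h
  · intro c hc
    obtain ⟨i, hi, rfl⟩ := Finset.mem_image.1 hc
    exact (Finset.mem_filter.1 hi).2.2
  · intro c hc d hd hcd
    obtain ⟨i, hi, rfl⟩ := Finset.mem_image.1 hc
    obtain ⟨i', hi', rfl⟩ := Finset.mem_image.1 hd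
    exact (Finset.mem_filter.1 hi').2.1 i fun h => hcd (h ▸ rfl)

/-- DOUBLE COUNTING: a set `P` of sites `r₀`-separated from everything, each with a site of `Q`
within `R`, has at most `(2R/r₀ + 1)³ · #Q` elements. [folklore] -/
private theorem card_le_mul_card' {N : ℕ} {y : Fin N → EuclideanSpace ℝ (Fin 3)}
    (hy : Function.Injective y) {r₀ R : ℝ} (hr₀ : 0 < r₀) (hR : 0 ≤ R) (P Q : Finset (Fin N))
    (hP : ∀ i ∈ P, (∀ k : Fin N, k ≠ i → r₀ ≤ dist (y k) (y i)) ∧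
      ∃ j ∈ Q, dist (y i) (y j) ≤ R) :
    (P.card : ℝ) ≤ (2 * R / r₀ + 1) ^ Module.finrank ℝ (EuclideanSpace ℝ (Fin 3)) * Q.card := by
  -- adapted from `card_le_mul_card` (…SeparatedDenseReduction.lean)
  set K : ℝ := (2 * R / r₀ + 1) ^ Module.finrank ℝ (EuclideanSpace ℝ (Fin 3)) with hK
  have hK0 : 0 ≤ K := by positivity
  let w : Fin N → Fin N := fun i =>
    if h : ∃ j ∈ Q, dist (y i) (y j) ≤ R then Classical.choose h else i
  have hw : ∀ i ∈ P, w i ∈ Q ∧ dist (y i) (y (w i)) ≤ R := by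
    intro i hi
    obtain ⟨-, hex⟩ := hP i hi
    simp only [w, dif_pos hex]
    exact Classical.choose_spec hex
  have himg : P.image w ⊆ Q := by
    intro j hj
    obtain ⟨i, hi, rfl⟩ := Finset.mem_image.1 hj
    exact (hw i hi).1
  have hfib : ∀ j ∈ P.image w, ((P.filter fun i => w i = j).card : ℝ) ≤ K := by
    intro j _
    have hsub : (P.filter fun i => w i = j) ⊆ Finset.univ.filter fun i : Fin N =>
        (∀ k : Fin N, k ≠ i → r₀ ≤ dist (y k) (y i)) ∧ dist (y i) (y j) ≤ R := by
      intro i hi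
      obtain ⟨hiP, hwi⟩ := Finset.mem_filter.1 hi
      refine Finset.mem_filter.2 ⟨Finset.mem_univ _, (hP i hiP).1, ?_⟩
      have := (hw i hiP).2
      rwa [hwi] at this
    calc ((P.filter fun i => w i = j).card : ℝ)
        ≤ ((Finset.univ.filter fun i : Fin N => (∀ k : Fin N, k ≠ i → r₀ ≤ dist (y k) (y i)) ∧
            dist (y i) (y j) ≤ R).card : ℝ) := by
          exact_mod_cast Finset.card_le_card hsub
      _ ≤ K := card_near_le' hy hr₀ hR j
  calc (P.card : ℝ) = ∑ j ∈ P.image w, ((P.filter fun i => w i = j).card : ℝ) := by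
        rw [Finset.card_eq_sum_card_image w P]
        push_cast
        rfl
    _ ≤ ∑ j ∈ P.image w, K := Finset.sum_le_sum hfib
    _ = K * (P.image w).card := by rw [Finset.sum_const, nsmul_eq_mul, mul_comm]
    _ ≤ K * Q.card := by
        have himg' : ((P.image w).card : ℝ) ≤ Q.card := by
          exact_mod_cast Finset.card_le_card himg
        exact mul_le_mul_of_nonneg_left himg' hK0

/-! ## Energies of sub-configurations (copies of c3's private lemmas) -/

/-- Dropping sites farther than the range `2` of `V` from every other site does not change the
energy. [folklore] -/
private theorem interactionEnergy_sub_eq' (V : ℝ → ℝ) (hV : ∀ r, 2 ≤ r → V r = 0)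
    {M L : ℕ} (x : Fin M → EuclideanSpace ℝ (Fin 3)) (g : Fin L ↪ Fin M)
    (hg : ∀ a : Fin M, a ∉ Set.range g → ∀ b : Fin M, b ≠ a → 2 < dist (x a) (x b)) :
    interactionEnergy V (x ∘ g) = interactionEnergy V x := by
  -- adapted from `interactionEnergy_sub_eq` (…SeparatedDenseReduction.lean)
  have h2 := two_mul_interactionEnergy V x
  have h2' := two_mul_interactionEnergy V (x ∘ g)
  suffices h : ∑ a, siteEnergy V x a = ∑ c, siteEnergy V (x ∘ g) c by linarith
  have hz : ∀ a b : Fin M, b ∉ Set.range g → a ≠ b → V (dist (x a) (x b)) = 0 :=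
    fun a b hb hab => hV _ (by rw [dist_comm]; exact (hg b hb a hab).le)
  have hnot : ∀ b : Fin M, b ∉ Finset.univ.map g → b ∉ Set.range g :=
    fun b hb hb' => hb ((mem_map_univ_iff' g b).2 hb')
  calc ∑ a, siteEnergy V x a = ∑ a ∈ Finset.univ.map g, siteEnergy V x a := by
        refine (Finset.sum_subset (Finset.subset_univ _) fun a _ ha => ?_).symm
        exact Finset.sum_eq_zero fun b hb =>
          hV _ (hg a (hnot a ha) b (Finset.ne_of_mem_erase hb)).le
    _ = ∑ c, siteEnergy V x (g c) := Finset.sum_map _ _ _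
    _ = ∑ c, siteEnergy V (x ∘ g) c := Finset.sum_congr rfl fun c _ => ?_
  unfold siteEnergy
  symm
  calc ∑ k ∈ Finset.univ.erase c, V (dist ((x ∘ g) c) ((x ∘ g) k))
      = ∑ b ∈ (Finset.univ.erase c).map g, V (dist (x (g c)) (x b)) := by
        rw [Finset.sum_map]
        rfl
    _ = ∑ b ∈ Finset.univ.erase (g c), V (dist (x (g c)) (x b)) := by
        refine Finset.sum_subset (fun b hb => ?_) fun b hb hb' => ?_
        · obtain ⟨k, hk, rfl⟩ := Finset.mem_map.1 hb
          exact Finset.mem_erase.2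
            ⟨fun h => Finset.ne_of_mem_erase hk (g.injective h), Finset.mem_univ _⟩
        · refine hz _ _ (fun ⟨k, hk⟩ => hb' (Finset.mem_map.2 ⟨k, ?_, hk⟩))
            (Finset.ne_of_mem_erase hb).symm
          exact Finset.mem_erase.2
            ⟨fun h => Finset.ne_of_mem_erase hb (by rw [← hk, h]), Finset.mem_univ _⟩

/-- **Superstability step.** The energy of an injective configuration is at least the energy of
its `1/4`-crowd-free sub-configuration (landed `stub_superstableRedistribution`). [folklore] -/
private theorem interactionEnergy_crowdFree_le' {N M : ℕ}
    (y : Fin N → EuclideanSpace ℝ (Fin 3)) (hy : Function.Injective y) (f : Fin M ↪ Fin N)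
    (hf : ∀ k : Fin N, k ∈ Set.range f ↔ ∀ k' : Fin N, k' ≠ k → 1 / 4 ≤ dist (y k') (y k)) :
    interactionEnergy (fun r => min 1 (max 0 (4 - 2 * r)) * lennardJones r) (y ∘ f) ≤
      interactionEnergy (fun r => min 1 (max 0 (4 - 2 * r)) * lennardJones r) y := by
  -- adapted from `interactionEnergy_crowdFree_le` (…SeparatedDenseReduction.lean)
  obtain ⟨ρ, F, -, hsum0, -, hcf, hcrowd⟩ := stub_superstableRedistribution
  set V : ℝ → ℝ := fun r => min 1 (max 0 (4 - 2 * r)) * lennardJones r with hV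
  have h2 := two_mul_interactionEnergy V y
  have h2' := two_mul_interactionEnergy V (y ∘ f)
  have hE : interactionEnergy V y = ∑ i, (siteEnergy V y i / 2 + F N y i) := by
    rw [Finset.sum_add_distrib, hsum0 N y hy, add_zero, ← Finset.sum_div]
    linarith
  have h1 : ∑ a, siteEnergy V (y ∘ f) a / 2 ≤
      ∑ i ∈ Finset.univ.map f, (siteEnergy V y i / 2 + F N y i) := by
    rw [Finset.sum_map]
    exact Finset.sum_le_sum fun a _ => hcf N M y f a hy hf
  have h3 : 0 ≤ ∑ i ∈ (Finset.univ.map f)ᶜ, (siteEnergy V y i / 2 + F N y i) :=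
    Finset.sum_nonneg fun i hi => by
      have hi' : i ∉ Set.range f := fun h =>
        (Finset.mem_compl.1 hi) ((mem_map_univ_iff' f i).2 h)
      linarith [hcrowd N y i hy fun h => hi' ((hf i).2 h)]
  rw [hE, ← Finset.sum_add_sum_compl (Finset.univ.map f)]
  have : interactionEnergy V (y ∘ f) = ∑ a, siteEnergy V (y ∘ f) a / 2 := by
    rw [← Finset.sum_div]
    linarith
  linarith

/-! ## The reduction -/

/-- **Compact-strata reduction of the Barlow far-site gap (FAR)**: the far-site gap on uniformly
`1/4`-separated, `2`-dense finite injective configurations implies the far-site gap on all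
finite injective configurations, i.e. (FAR) — by superstability (p124427), periodic stability
(p84999) and FAR-LOCALITY (`nearBarlow_sub_iff`). [folklore] -/
theorem farSiteGap_of_separatedDense : (∃ κ : ℝ, 0 < κ ∧ ∀ (N : ℕ) (y : Fin N → EuclideanSpace ℝ (Fin 3)), Function.Injective y → (∀ j k : Fin N, j ≠ k → 1 / 4 ≤ dist (y j) (y k)) → (∀ j : Fin N, ∃ k : Fin N, k ≠ j ∧ dist (y j) (y k) ≤ 2) → (N : ℝ) * (⨅ Q : Literature.MathematicalPhysics.StatisticalMechanics.PeriodicConfiguration 3, Q.energyPerParticle (fun r => min 1 (max 0 (4 - 2 * r)) * Literature.MathematicalPhysics.StatisticalMechanics.lennardJones r)) + κ * (Nat.card {i : Fin N // ¬ ∃ (a c : ℝ) (s : ℤ → ℤ) (g : EuclideanSpace ℝ (Fin 3) ≃ᵃⁱ[ℝ] EuclideanSpace ℝ (Fin 3)), 93 / 100 ≤ a ∧ a ≤ 51 / 50 ∧ 78 / 100 * a ≤ c ∧ c ≤ 86 / 100 * a ∧ Literature.MathematicalPhysics.StatisticalMechanics.IsHaggSeq s ∧ (∀ j k : Fin N,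 j ≠ k → dist (y j) (y i) ≤ 3 * a → a / 2 ≤ dist (y j) (y k)) ∧ (∀ j : Fin N, dist (y j) (y i) ≤ 3 * a → ∃ z ∈ Literature.MathematicalPhysics.StatisticalMechanics.barlowStacking a c s, dist (y j) (g z) ≤ a / 50) ∧ (∀ z ∈ Literature.MathematicalPhysics.StatisticalMechanics.barlowStacking a c s, dist (g z) (y i) ≤ 3 * a → ∃ j : Fin N, dist (y j) (g z) ≤ a / 50)} : ℝ) ≤ Literature.MathematicalPhysics.StatisticalMechanics.interactionEnergy (fun r => min 1 (max 0 (4 - 2 * r)) * Literature.MathematicalPhysics.StatisticalMechanics.lennardJones r) y) → (∃ κ : ℝ, 0 < κ ∧ ∀ (N : ℕ) (y : Fin N → EuclideanSpace ℝ (Fin 3)), Function.Injective y → (N : ℝ) * (⨅ Q : Literature.MathematicalPhysics.StatisticalMechanics.PeriodicConfiguration 3, Q.energyPerParticle (fun r => min 1 (max 0 (4 - 2 * r)) * Literature.MathematicalPhysics.StatisticalMechanics.lennardJones r)) + κ * (Nat.card {i : Fin N // ¬ ∃ (a c : ℝ) (s : ℤ → ℤ) (g : EuclideanSpace ℝ (Fin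 3) ≃ᵃⁱ[ℝ] EuclideanSpace ℝ (Fin 3)), 93 / 100 ≤ a ∧ a ≤ 51 / 50 ∧ 78 / 100 * a ≤ c ∧ c ≤ 86 / 100 * a ∧ Literature.MathematicalPhysics.StatisticalMechanics.IsHaggSeq s ∧ (∀ j k : Fin N, j ≠ k → dist (y j) (y i) ≤ 3 * a → a / 2 ≤ dist (y j) (y k)) ∧ (∀ j : Fin N, dist (y j) (y i) ≤ 3 * a → ∃ z ∈ Literature.MathematicalPhysics.StatisticalMechanics.barlowStacking a c s, dist (y j) (g z) ≤ a / 50) ∧ (∀ z ∈ Literature.MathematicalPhysics.StatisticalMechanics.barlowStacking a c s, dist (g z) (y i) ≤ 3 * a → ∃ j : Fin N, dist (y j) (g z) ≤ a / 50)} : ℝ) ≤ Literature.MathematicalPhysics.StatisticalMechanics.interactionEnergy (fun r => min 1 (max 0 (4 - 2 * r)) * Literature.MathematicalPhysics.StatisticalMechanics.lennardJones r) y) := by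
  intro hsep
  obtain ⟨κ, hκ, hgap⟩ := hsep
  -- (e) `e* ≤ -1/24` from the pair cluster and periodic stability
  have heStar : (⨅ Q : PeriodicConfiguration 3,
      Q.energyPerParticle (fun r => min 1 (max 0 (4 - 2 * r)) * lennardJones r)) ≤ -1 / 24 := by
    have h := iInf_energyPerParticle_le_div (R := 2) truncLJ_eq_zero_of_two_le
      stub_periodicStability injective_pair_zero_single (by norm_num : (0 : ℕ) < 2)
    rw [interactionEnergy_truncLJ_pair] at h
    norm_num at h
    linarith
  -- constants
  set K : ℝ := (2 * (357 / 100) / (1 / 4) + 1) ^ Module.finrank ℝ (EuclideanSpace ℝ (Fin 3))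
    with hK
  have hK0 : 0 ≤ K := by positivity
  have hK1 : 0 < K + 1 := by linarith
  have hκ' : 0 < min κ (1 / (24 * (K + 1))) := lt_min hκ (by positivity)
  refine ⟨min κ (1 / (24 * (K + 1))), hκ', fun N y hy => ?_⟩
  set κ' : ℝ := min κ (1 / (24 * (K + 1))) with hκ'def
  have hκ'le1 : κ' ≤ κ := min_le_left _ _
  have hκ'le2 : κ' * (K + 1) ≤ 1 / 24 :=
    calc κ' * (K + 1) ≤ 1 / (24 * (K + 1)) * (K + 1) :=
          mul_le_mul_of_nonneg_right (min_le_right _ _) hK1.le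
      _ = 1 / 24 := by field_simp
  -- (a) the crowd-free sites are the range of `f`
  obtain ⟨M, f, hf⟩ :=
    exists_enum' fun k : Fin N => ∀ k' : Fin N, k' ≠ k → 1 / 4 ≤ dist (y k') (y k)
  have hcf : ∀ a : Fin M, ∀ k' : Fin N, k' ≠ f a → 1 / 4 ≤ dist (y k') (y (f a)) :=
    fun a => (hf (f a)).1 ⟨a, rfl⟩
  -- (c) the non-isolated crowd-free sites are the range of `g`; `z` is their configuration
  obtain ⟨L, g, hg⟩ :=
    exists_enum' fun a : Fin M => ¬ ∀ b : Fin M, b ≠ a → 2 < dist (y (f a)) (y (f b))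
  set e : Fin L ↪ Fin N := g.trans f with he
  have hze : Function.Injective (y ∘ e) := hy.comp e.injective
  have hzsep : ∀ j k : Fin L, j ≠ k → 1 / 4 ≤ dist ((y ∘ e) j) ((y ∘ e) k) := fun j k hjk =>
    hcf (g k) (f (g j)) fun h => hjk (g.injective (f.injective h))
  have hzdense : ∀ j : Fin L, ∃ k : Fin L, k ≠ j ∧ dist ((y ∘ e) j) ((y ∘ e) k) ≤ 2 := by
    intro c
    have h1 : ¬ ∀ b : Fin M, b ≠ g c → 2 < dist (y (f (g c))) (y (f b)) :=
      (hg (g c)).1 ⟨c, rfl⟩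
    push Not at h1
    obtain ⟨b, hb, hd⟩ := h1
    obtain ⟨c', hc'⟩ := (hg b).2 fun h => by
      have := h (g c) hb.symm
      rw [dist_comm] at this
      linarith
    refine ⟨c', fun h => hb ?_, ?_⟩
    · rw [← hc', h]
    · change dist (y (f (g c))) (y (f (g c'))) ≤ 2
      rw [hc']
      exact hd
  have hEz : interactionEnergy (fun r => min 1 (max 0 (4 - 2 * r)) * lennardJones r) (y ∘ e) ≤
      interactionEnergy (fun r => min 1 (max 0 (4 - 2 * r)) * lennardJones r) y := by
    have h1 : interactionEnergy (fun r => min 1 (max 0 (4 - 2 * r)) * lennardJones r)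
        ((y ∘ f) ∘ g) =
        interactionEnergy (fun r => min 1 (max 0 (4 - 2 * r)) * lennardJones r) (y ∘ f) :=
      interactionEnergy_sub_eq' _ truncLJ_eq_zero_of_two_le (y ∘ f) g fun a ha =>
        not_not.1 (mt (hg a).2 ha)
    have h2 : (y ∘ e) = (y ∘ f) ∘ g := funext fun c => rfl
    rw [h2, h1]
    exact interactionEnergy_crowdFree_le' y hy f hf
  -- (d) the hypothesis prices `z = y ∘ e`
  have hgz := hgap L (y ∘ e) hze hzsep hzdense
  -- (f) the far counts, as finsets; FAR-LOCALITY feeds the double counting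
  set Fy := Finset.univ.filter fun i : Fin N => ¬ ∃ (a c : ℝ) (s : ℤ → ℤ) (g : EuclideanSpace ℝ (Fin 3) ≃ᵃⁱ[ℝ] EuclideanSpace ℝ (Fin 3)), 93 / 100 ≤ a ∧ a ≤ 51 / 50 ∧ 78 / 100 * a ≤ c ∧ c ≤ 86 / 100 * a ∧ Literature.MathematicalPhysics.StatisticalMechanics.IsHaggSeq s ∧ (∀ j k : Fin N, j ≠ k → dist (y j) (y i) ≤ 3 * a → a / 2 ≤ dist (y j) (y k)) ∧ (∀ j : Fin N, dist (y j) (y i) ≤ 3 * a → ∃ z ∈ Literature.MathematicalPhysics.StatisticalMechanics.barlowStacking a c s, dist (y j) (g z) ≤ a / 50) ∧ (∀ z ∈ Literature.MathematicalPhysics.StatisticalMechanics.barlowStacking a c s, dist (g z) (y i) ≤ 3 * a → ∃ j : Fin N, dist (y j) (g z) ≤ a / 50) with hFy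
  set Fz := Finset.univ.filter fun i : Fin L => ¬ ∃ (a c : ℝ) (s : ℤ → ℤ) (g : EuclideanSpace ℝ (Fin 3) ≃ᵃⁱ[ℝ] EuclideanSpace ℝ (Fin 3)), 93 / 100 ≤ a ∧ a ≤ 51 / 50 ∧ 78 / 100 * a ≤ c ∧ c ≤ 86 / 100 * a ∧ Literature.MathematicalPhysics.StatisticalMechanics.IsHaggSeq s ∧ (∀ j k : Fin L, j ≠ k → dist ((y ∘ e) j) ((y ∘ e) i) ≤ 3 * a → a / 2 ≤ dist ((y ∘ e) j) ((y ∘ e) k)) ∧ (∀ j : Fin L, dist ((y ∘ e) j) ((y ∘ e) i) ≤ 3 * a → ∃ z ∈ Literature.MathematicalPhysics.StatisticalMechanics.barlowStacking a c s, dist ((y ∘ e) j) (g z) ≤ a / 50) ∧ (∀ z ∈ Literature.MathematicalPhysics.StatisticalMechanics.barlowStacking a c s, dist (g z) ((y ∘ e) i) ≤ 3 * a → ∃ j : Fin L, dist ((y ∘ e) j) (g z) ≤ a / 50) with hFz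
  have hloc : ∀ i₀ : Fin L, e i₀ ∈ Fy → i₀ ∉ Fz →
      ∃ k : Fin N, k ∉ Set.range e ∧ dist (y k) (y (e i₀)) ≤ 357 / 100 := by
    intro i₀ hcy hcz
    by_contra hall
    push Not at hall
    have key := nearBarlow_sub_iff N L y e i₀ fun k hk => by
      by_contra hke
      exact absurd hk (not_le.2 (hall k hke))
    have hzc : ∃ (a c : ℝ) (s : ℤ → ℤ) (g : EuclideanSpace ℝ (Fin 3) ≃ᵃⁱ[ℝ] EuclideanSpace ℝ (Fin 3)), 93 / 100 ≤ a ∧ a ≤ 51 / 50 ∧ 78 / 100 * a ≤ c ∧ c ≤ 86 / 100 * a ∧ Literature.MathematicalPhysics.StatisticalMechanics.IsHaggSeq s ∧ (∀ j k : Fin L, j ≠ k → dist ((y ∘ e) j) ((y ∘ e) i₀) ≤ 3 * a → a / 2 ≤ dist ((y ∘ e) j) ((y ∘ e) k)) ∧ (∀ j : Fin L, dist ((y ∘ e) j) ((y ∘ e) i₀) ≤ 3 * a → ∃ z ∈ Literature.MathematicalPhysics.StatisticalMechanics.barlowStacking a c s, dist ((y ∘ e) j) (g z) ≤ a / 50)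 ∧ (∀ z ∈ Literature.MathematicalPhysics.StatisticalMechanics.barlowStacking a c s, dist (g z) ((y ∘ e) i₀) ≤ 3 * a → ∃ j : Fin L, dist ((y ∘ e) j) (g z) ≤ a / 50) := by
      by_contra hn
      exact hcz (Finset.mem_filter.2 ⟨Finset.mem_univ _, hn⟩)
    exact (Finset.mem_filter.1 hcy).2 (key.2 hzc)
  -- hide the predicates: from here on only the finsets and `hloc` are used
  clear_value Fy Fz
  have hcardy : (Nat.card {i : Fin N // ¬ ∃ (a c : ℝ) (s : ℤ → ℤ) (g : EuclideanSpace ℝ (Fin 3) ≃ᵃⁱ[ℝ] EuclideanSpace ℝ (Fin 3)), 93 / 100 ≤ a ∧ a ≤ 51 / 50 ∧ 78 / 100 * a ≤ c ∧ c ≤ 86 / 100 * a ∧ Literature.MathematicalPhysics.StatisticalMechanics.IsHaggSeq s ∧ (∀ j k : Fin N, j ≠ k → dist (y j) (y i) ≤ 3 * a → a / 2 ≤ dist (y j) (y k)) ∧ (∀ j : Fin N, dist (y j) (y i) ≤ 3 * a → ∃ z ∈ Literature.MathematicalPhysics.StatisticalMechanics.barlowStacking a c s, dist (y j) (g z) ≤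 a / 50) ∧ (∀ z ∈ Literature.MathematicalPhysics.StatisticalMechanics.barlowStacking a c s, dist (g z) (y i) ≤ 3 * a → ∃ j : Fin N, dist (y j) (g z) ≤ a / 50)} : ℝ) = Fy.card := by
    rw [hFy, Nat.card_eq_fintype_card, Fintype.card_subtype]
  have hcardz : (Nat.card {i : Fin L // ¬ ∃ (a c : ℝ) (s : ℤ → ℤ) (g : EuclideanSpace ℝ (Fin 3) ≃ᵃⁱ[ℝ] EuclideanSpace ℝ (Fin 3)), 93 / 100 ≤ a ∧ a ≤ 51 / 50 ∧ 78 / 100 * a ≤ c ∧ c ≤ 86 / 100 * a ∧ Literature.MathematicalPhysics.StatisticalMechanics.IsHaggSeq s ∧ (∀ j k : Fin L, j ≠ k → dist ((y ∘ e) j) ((y ∘ e) i) ≤ 3 * a → a / 2 ≤ dist ((y ∘ e) j) ((y ∘ e) k)) ∧ (∀ j : Fin L, dist ((y ∘ e) j) ((y ∘ e) i) ≤ 3 * a → ∃ z ∈ Literature.MathematicalPhysics.StatisticalMechanics.barlowStacking a c s, dist ((y ∘ e) j) (g z) ≤ a / 50) ∧ (∀ z ∈ Literature.MathematicalPhysics.StatisticalMechanics.barlowStacking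 a c s, dist (g z) ((y ∘ e) i) ≤ 3 * a → ∃ j : Fin L, dist ((y ∘ e) j) (g z) ≤ a / 50)} : ℝ) = Fz.card := by
    rw [hFz, Nat.card_eq_fintype_card, Fintype.card_subtype]
  rw [hcardy]
  rw [hcardz] at hgz
  clear hcardy hcardz hFy hFz hgap
  set Q := (Finset.univ.map e)ᶜ with hQ
  set P := Fy.filter fun j => ∃ c : Fin L, e c = j ∧ c ∉ Fz with hP
  have hNL : (N : ℝ) = L + Q.card := by
    have h := Finset.card_add_card_compl (Finset.univ.map e)
    rw [Finset.card_map, Finset.card_univ, Fintype.card_fin, Fintype.card_fin] at h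
    exact_mod_cast h.symm
  have hcover : Fy ⊆ Q ∪ P ∪ Fz.map e := by
    intro j hj
    by_cases hjm : j ∈ Finset.univ.map e
    · obtain ⟨c, -, rfl⟩ := Finset.mem_map.1 hjm
      by_cases hc : c ∈ Fz
      · exact Finset.mem_union_right _ (Finset.mem_map_of_mem e hc)
      · exact Finset.mem_union_left _
          (Finset.mem_union_right _ (Finset.mem_filter.2 ⟨hj, c, rfl, hc⟩))
    · exact Finset.mem_union_left _ (Finset.mem_union_left _ (Finset.mem_compl.2 hjm))
  have hcardCh : (Fy.card : ℝ) ≤ Q.card + P.card + Fz.card := by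
    have h1 := Finset.card_le_card hcover
    have h2 := Finset.card_union_le (Q ∪ P) (Fz.map e)
    have h3 := Finset.card_union_le Q P
    rw [Finset.card_map] at h2
    exact_mod_cast h1.trans (h2.trans (Nat.add_le_add_right h3 _))
  -- locality: a site of `P` has a dropped site within `357/100`
  have hPw : ∀ j ∈ P, (∀ k : Fin N, k ≠ j → 1 / 4 ≤ dist (y k) (y j)) ∧
      ∃ k ∈ Q, dist (y j) (y k) ≤ 357 / 100 := by
    intro j hj
    obtain ⟨hjF, c, rfl, hcz⟩ := Finset.mem_filter.1 hj
    refine ⟨hcf (g c), ?_⟩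
    obtain ⟨k, hke, hk⟩ := hloc c hjF hcz
    refine ⟨k, Finset.mem_compl.2 fun h => hke ((mem_map_univ_iff' e k).1 h), ?_⟩
    rw [dist_comm]
    exact hk
  have hPle : (P.card : ℝ) ≤ K * Q.card :=
    card_le_mul_card' hy (by norm_num : (0 : ℝ) < 1 / 4) (by norm_num : (0 : ℝ) ≤ 357 / 100)
      P Q hPw
  -- (g) assemble
  have hq0 : (0 : ℝ) ≤ Q.card := Nat.cast_nonneg _
  have hFz0 : (0 : ℝ) ≤ Fz.card := Nat.cast_nonneg _
  have h1 := mul_le_mul_of_nonneg_left heStar hq0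
  have h2 : κ' * P.card ≤ κ' * (K * Q.card) := mul_le_mul_of_nonneg_left hPle hκ'.le
  have h3 : κ' * (K + 1) * Q.card ≤ 1 / 24 * Q.card := mul_le_mul_of_nonneg_right hκ'le2 hq0
  have h4 : κ' * Fz.card ≤ κ * Fz.card := mul_le_mul_of_nonneg_right hκ'le1 hFz0
  have h5 : κ' * Fy.card ≤ κ' * (Q.card + P.card + Fz.card) :=
    mul_le_mul_of_nonneg_left hcardCh hκ'.le
  rw [hNL]
  linarith

end Summit.AtomisticToContinuum.Crystallization.Theorems.PricedLinkCensusTruncatedCensusGap
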